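import Summits.CriticalPhenomena.PercolationContinuityZ3.Theorems.Transplant.SkelPhiFaceRouteReadings
import HarnessLib

/-!
# N1 ({±1} node), (F) inner route, part R5b-vii (hp-8 g33): **THE NUMERIC CROSS LINK x-RUN → y′-RUN FOR THE CANONICAL TANGENTIAL ORIGIN** —
# the field `hxyX` of the per-centre numbers, DISCHARGED once and for all for the choice
# `yT − yL := (σ(N_r+1)·n + σ_T·v, σ(N_r+1)·h + ⌊σ_T·h·v / n⌋)` (the nominal end of the x-run shifted transversally to the centre `−v` of the
# y′-window `[−(n+v), n−v]`, and sheared so that the residual `β′` is `< n ≤ U`): the last x-core lands in core `0` of the y′-run as soon as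
# `q + (N_r+1)·R′ ≤ n` (along spread fits the steering window) and `W + (N_r+1)·R′ + 2 ≤ q₃` (transverse spread fits the start box).
builds on p205010 (kernel theorem, internal audit signed; external expert review pending) — nothing in this file uses p205010; no claim about the open node.
Lane `prim-bschramm`, seat `prim-hp-8` (gen 33); helper file (`--supports stmt-CriticalPhenomena-4575 --as helper`).
* `Skelφ.crossOffX` (the canonical `yT − yL`), **`Skelφ.hxyX_of_floors`**.
[cite: KozmaNitzan2024, §4 Lemma 12 (pp. 23–25)] [cite: MartineauTassion2017, §4.3 Lemma 4.2]
-/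

noncomputable section

open scoped Classical

namespace Summit.CriticalPhenomena.PercolationContinuityZ3.Theorems.Transplant

namespace Skelφ

open Literature.Probability.Percolation Literature.Probability.LatticeModels
open ChainPlanar ChainPara

/-- **The canonical offset `yT − yL`** from the along x-run's origin to the tangential y′-run's origin. [this work] -/
def crossOffX (n : ℕ) (h v σ σT : ℤ) (Nr : ℕ) : Site 2 :=
  pt (σ * (((Nr : ℤ) + 1) * n) + σT * v) (σ * (((Nr : ℤ) + 1) * h) + σT * h * v / n)

/-- **THE NUMERIC CROSS LINK x → y′** for the canonical offset (see the module docstring). [cite: KozmaNitzan2024, §4 Lemma 12 (pp. 23–25)] -/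
theorem hxyX_of_floors {n : ℕ} (hn : 1 ≤ n) {h v σ σT : ℤ} (hv : |v| ≤ n) (hσ : σ = 1 ∨ σ = -1) (hσT : σT = 1 ∨ σT = -1)
    (ℓ R' q Nr R'₃ q₃ N₃ : ℕ) (hfit : (q : ℤ) + ((Nr : ℤ) + 1) * R' ≤ n)
    (hq₃ : ((n * ℓ / shearUnit n h + 1 : ℕ) : ℤ) + ((Nr : ℤ) + 1) * R' + 2 ≤ q₃) :
    ∀ a s : ℤ, (xPrmW n ℓ h R' q Nr).aLo (Nr + 1) ≤ a → a ≤ (xPrmW n ℓ h R' q Nr).aHi (Nr + 1) →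
      (xPrmW n ℓ h R' q Nr).bLo (Nr + 1) ≤ s / (shearUnit n h : ℤ) → s / (shearUnit n h : ℤ) ≤ (xPrmW n ℓ h R' q Nr).bHi (Nr + 1) →
      (yPrmW n ℓ h v R'₃ q₃ N₃).InCore 0
        ((σT * σ * s - σT * ((n : ℤ) * (crossOffX n h v σ σT Nr) 1 - h * (crossOffX n h v σ σT Nr) 0)) / (shearUnit n h : ℤ))
        (σT * σ * a - σT * (crossOffX n h v σ σT Nr) 0) := by
  intro a s ha1 ha2 hb1 hb2
  have hU0 : 0 < (shearUnit n h : ℤ) := shearUnit_pos hn h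
  have hnU : (n : ℤ) ≤ shearUnit n h := by
    unfold shearUnit; push_cast; linarith [abs_nonneg h]
  have hn0 : (0 : ℤ) < n := by exact_mod_cast hn
  have hσTsq : σT * σT = 1 := by rcases hσT with rfl | rfl <;> norm_num
  have hσabs : |σ| = 1 := by rcases hσ with h1 | h1 <;> simp [h1]
  have hσTabs : |σT| = 1 := by rcases hσT with h1 | h1 <;> simp [h1]
  simp only [xPrmW, RunPrm.aLo, RunPrm.aHi, RunPrm.bLo, RunPrm.bHi, Nat.cast_add, Nat.cast_one, mul_zero, zero_sub, zero_add] at ha1 ha2 hb1 hb2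
  simp only [Nat.cast_add, Nat.cast_one] at hq₃
  set W' : ℤ := ((n * ℓ / shearUnit n h : ℕ) : ℤ) + 1 + ((Nr : ℤ) + 1) * R' with hW'
  rw [RunPrm.inCore_zero_iff]
  have hWm : ((yPrmW n ℓ h v R'₃ q₃ N₃).Wm : ℤ) = n + v := by
    show ((((n : ℤ) + v).toNat : ℕ) : ℤ) = n + v
    rw [Int.toNat_of_nonneg (by linarith [abs_le.1 hv])]
  have hWp : ((yPrmW n ℓ h v R'₃ q₃ N₃).Wp : ℤ) = n - v := by
    show ((((n : ℤ) - v).toNat : ℕ) : ℤ) = n - v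
    rw [Int.toNat_of_nonneg (by linarith [abs_le.1 hv])]
  have hq : ((yPrmW n ℓ h v R'₃ q₃ N₃).q : ℤ) = q₃ := rfl
  rw [hWm, hWp, hq]
  -- the transverse coordinate
  have e0 : (crossOffX n h v σ σT Nr) 0 = σ * (((Nr : ℤ) + 1) * n) + σT * v := by simp [crossOffX]
  have e1 : (crossOffX n h v σ σT Nr) 1 = σ * (((Nr : ℤ) + 1) * h) + σT * h * v / n := by simp [crossOffX]
  have hB : σT * σ * a - σT * (crossOffX n h v σ σT Nr) 0 = σT * σ * (a - ((Nr : ℤ) + 1) * n) - v := by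
    rw [e0]
    have : σT * (σ * (((Nr : ℤ) + 1) * n) + σT * v) = σT * σ * (((Nr : ℤ) + 1) * n) + σT * σT * v := by ring
    rw [this, hσTsq]; ring
  have habs : |σT * σ * (a - ((Nr : ℤ) + 1) * n)| ≤ (q : ℤ) + ((Nr : ℤ) + 1) * R' := by
    rw [abs_mul, abs_mul, hσTabs, hσabs, one_mul, one_mul, abs_le]
    constructor <;> linarith
  have hB' := abs_le.1 habs
  -- the along coordinate: residual shear `ρ ∈ (−n, 0]`
  set ρ : ℤ := (n : ℤ) * (σT * h * v / n) - σT * h * v with hρ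
  have hdm := Int.mul_ediv_add_emod (σT * h * v) (n : ℤ)
  have hρ1 : ρ ≤ 0 := by have h1 := Int.emod_nonneg (σT * h * v) hn0.ne'; rw [hρ]; linarith
  have hρ2 : -(n : ℤ) < ρ := by have h1 := Int.emod_lt_of_pos (σT * h * v) hn0; rw [hρ]; linarith
  have hA : (n : ℤ) * (crossOffX n h v σ σT Nr) 1 - h * (crossOffX n h v σ σT Nr) 0 = ρ := by rw [e0, e1, hρ]; ring
  rw [hA]
  -- bounds on `s`
  have hs1 : -W' * (shearUnit n h : ℤ) ≤ s := by
    have h1 := Int.ediv_mul_le s hU0.ne'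
    have h2 : (-W') * (shearUnit n h : ℤ) ≤ s / (shearUnit n h : ℤ) * shearUnit n h := mul_le_mul_of_nonneg_right hb1 hU0.le
    linarith
  have hs2 : s < (W' + 1) * (shearUnit n h : ℤ) := by
    have h1 := Int.lt_ediv_add_one_mul_self s hU0
    have h2 : (s / (shearUnit n h : ℤ) + 1) * (shearUnit n h : ℤ) ≤ (W' + 1) * (shearUnit n h : ℤ) :=
      mul_le_mul_of_nonneg_right (by linarith) hU0.le
    linarith
  have hσs : |σT * σ * s| = |s| := by rw [abs_mul, abs_mul, hσTabs, hσabs, one_mul, one_mul]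
  have hσρ : |σT * ρ| = |ρ| := by rw [abs_mul, hσTabs, one_mul]
  have hsabs : |s| ≤ (W' + 1) * (shearUnit n h : ℤ) - 1 := by
    rw [abs_le]; constructor <;> linarith
  have hρabs : |ρ| ≤ (n : ℤ) - 1 := by rw [abs_le]; constructor <;> linarith
  have eU : (W' + 2) * (shearUnit n h : ℤ) = (W' + 1) * shearUnit n h + shearUnit n h := by ring
  have hnum1 : -(W' + 2) * (shearUnit n h : ℤ) ≤ σT * σ * s - σT * ρ := by
    have h1 := neg_abs_le (σT * σ * s); have h2 := le_abs_self (σT * ρ); rw [hσs] at h1; rw [hσρ] at h2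
    linarith
  have hnum2 : σT * σ * s - σT * ρ < (W' + 2) * (shearUnit n h : ℤ) := by
    have h1 := le_abs_self (σT * σ * s); have h2 := neg_abs_le (σT * ρ); rw [hσs] at h1; rw [hσρ] at h2
    linarith
  refine ⟨?_, ?_, by linarith, by linarith⟩
  · rw [Int.le_ediv_iff_mul_le hU0]
    have := mul_le_mul_of_nonneg_right hq₃ hU0.le
    linarith
  · have : (σT * σ * s - σT * ρ) / (shearUnit n h : ℤ) < W' + 2 := by rw [Int.ediv_lt_iff_lt_mul hU0]; linarith
    linarith

/-! ## The y′-face mirror: along y′-run → tangential x-run -/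

/-- **The canonical offset `yT − yL` for a y′-face**: transversally the drifted centre `σ(N_r+1)·v`, along the sheared start of the last core
`β′ = σ(N_r+1)·sLo·U` up to a residual `< n` (`sLo = ⌊(nℓ − U + 1)/U⌋`). [this work] -/
def crossOffY (n ℓ : ℕ) (h v σ : ℤ) (Nr : ℕ) : Site 2 :=
  pt (σ * (((Nr : ℤ) + 1) * v))
    ((σ * (((Nr : ℤ) + 1) * (((n : ℤ) * ℓ - (shearUnit n h : ℕ) + 1) / (shearUnit n h : ℕ))) * (shearUnit n h : ℤ) + h * (σ * (((Nr : ℤ) + 1) * v))) / n)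

/-- **THE NUMERIC CROSS LINK y′ → x** for the canonical offset: the last y′-core lands in core `0` of the tangential x-run as soon as
`2n + (N_r+1)R′ ≤ q₃` and `(N_r+1)(sHi − sLo) + q + (N_r+1)R′ + 2 ≤ W` (`W = nℓ/U + 1`). [cite: KozmaNitzan2024, §4 Lemma 12 (pp. 23–25)] -/
theorem hxyY_of_floors {n : ℕ} (hn : 1 ≤ n) {h v σ σT : ℤ} (hv : |v| ≤ n) (hσ : σ = 1 ∨ σ = -1) (hσT : σT = 1 ∨ σT = -1)
    (ℓ R' q Nr R'₃ q₃ N₃ : ℕ) (hq₃ : 2 * (n : ℤ) + ((Nr : ℤ) + 1) * R' ≤ q₃)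
    (hW : ((Nr : ℤ) + 1) * (((n : ℤ) * ℓ / (shearUnit n h : ℕ) + 1) - ((n : ℤ) * ℓ - (shearUnit n h : ℕ) + 1) / (shearUnit n h : ℕ)) + q +
      ((Nr : ℤ) + 1) * R' + 2 ≤ ((n * ℓ / shearUnit n h + 1 : ℕ) : ℤ)) :
    ∀ a s : ℤ, (yPrmW n ℓ h v R' q Nr).aLo (Nr + 1) ≤ s / (shearUnit n h : ℤ) → s / (shearUnit n h : ℤ) ≤ (yPrmW n ℓ h v R' q Nr).aHi (Nr + 1) →
      (yPrmW n ℓ h v R' q Nr).bLo (Nr + 1) ≤ a → a ≤ (yPrmW n ℓ h v R' q Nr).bHi (Nr + 1) →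
      (xPrmW n ℓ h R'₃ q₃ N₃).InCore 0 (σT * σ * a - σT * (crossOffY n ℓ h v σ Nr) 0)
        ((σT * σ * s - σT * ((n : ℤ) * (crossOffY n ℓ h v σ Nr) 1 - h * (crossOffY n ℓ h v σ Nr) 0)) / (shearUnit n h : ℤ)) := by
  intro a s hs1 hs2 ha1 ha2
  have hU0 : 0 < (shearUnit n h : ℤ) := shearUnit_pos hn h
  have hnU : (n : ℤ) ≤ shearUnit n h := by
    unfold shearUnit; push_cast; linarith [abs_nonneg h]
  have hn0 : (0 : ℤ) < n := by exact_mod_cast hn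
  have hσsq : σ * σ = 1 := by rcases hσ with rfl | rfl <;> norm_num
  have hσabs : |σ| = 1 := by rcases hσ with h1 | h1 <;> simp [h1]
  have hσTabs : |σT| = 1 := by rcases hσT with h1 | h1 <;> simp [h1]
  have hvv := abs_le.1 hv
  simp only [yPrmW, RunPrm.aLo, RunPrm.aHi, RunPrm.bLo, RunPrm.bHi, Nat.cast_add, Nat.cast_one] at hs1 hs2 ha1 ha2
  rw [Int.toNat_of_nonneg (by linarith : (0 : ℤ) ≤ (n : ℤ) + v)] at ha1
  rw [Int.toNat_of_nonneg (by linarith : (0 : ℤ) ≤ (n : ℤ) - v)] at ha2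
  set sLo : ℤ := ((n : ℤ) * ℓ - (shearUnit n h : ℕ) + 1) / (shearUnit n h : ℕ) with hsLo
  set sHi : ℤ := (n : ℤ) * ℓ / (shearUnit n h : ℕ) + 1 with hsHi
  set k : ℤ := (Nr : ℤ) + 1 with hk
  rw [RunPrm.inCore_zero_iff]
  have hq : ((xPrmW n ℓ h R'₃ q₃ N₃).q : ℤ) = q₃ := rfl
  have hWm : ((xPrmW n ℓ h R'₃ q₃ N₃).Wm : ℤ) = ((n * ℓ / shearUnit n h + 1 : ℕ) : ℤ) := rfl
  have hWp : ((xPrmW n ℓ h R'₃ q₃ N₃).Wp : ℤ) = ((n * ℓ / shearUnit n h + 1 : ℕ) : ℤ) := rfl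
  rw [hq, hWm, hWp]
  have e0 : (crossOffY n ℓ h v σ Nr) 0 = σ * (k * v) := by simp [crossOffY, hk]
  have e1 : (crossOffY n ℓ h v σ Nr) 1 = (σ * (k * sLo) * (shearUnit n h : ℤ) + h * (σ * (k * v))) / n := by
    simp [crossOffY, hk, hsLo]
  -- the transverse coordinate of the x-frame: `σTσ(a − k v)`
  have hA : σT * σ * a - σT * (crossOffY n ℓ h v σ Nr) 0 = σT * σ * (a - k * v) := by rw [e0]; ring
  have hAabs : |σT * σ * (a - k * v)| ≤ 2 * (n : ℤ) + k * R' := by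
    rw [abs_mul, abs_mul, hσTabs, hσabs, one_mul, one_mul, abs_le]
    constructor <;> linarith
  have hA' := abs_le.1 hAabs
  -- the along coordinate: `β′(d) = σ k sLo U − r`, `0 ≤ r < n`
  set X : ℤ := σ * (k * sLo) * (shearUnit n h : ℤ) + h * (σ * (k * v)) with hX
  have hdm := Int.mul_ediv_add_emod X (n : ℤ)
  have hr0 := Int.emod_nonneg X hn0.ne'
  have hr1 := Int.emod_lt_of_pos X hn0
  have hB : (n : ℤ) * (crossOffY n ℓ h v σ Nr) 1 - h * (crossOffY n ℓ h v σ Nr) 0 = σ * (k * sLo) * (shearUnit n h : ℤ) - X % n := by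
    rw [e1, e0]; linarith
  rw [hA, hB]
  -- bounds on `s`
  have hsl : (k * sLo - q - k * R') * (shearUnit n h : ℤ) ≤ s := by
    have h1 := Int.ediv_mul_le s hU0.ne'
    have h2 : (k * sLo - q - k * R') * (shearUnit n h : ℤ) ≤ s / (shearUnit n h : ℤ) * shearUnit n h := mul_le_mul_of_nonneg_right hs1 hU0.le
    linarith
  have hsu : s < (k * sHi + q + k * R' + 1) * (shearUnit n h : ℤ) := by
    have h1 := Int.lt_ediv_add_one_mul_self s hU0
    have h2 : (s / (shearUnit n h : ℤ) + 1) * (shearUnit n h : ℤ) ≤ (k * sHi + q + k * R' + 1) * (shearUnit n h : ℤ) :=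
      mul_le_mul_of_nonneg_right (by linarith) hU0.le
    linarith
  -- numerator = σTσ (s − k sLo U) + σT (X % n)
  have hnum : σT * σ * s - σT * (σ * (k * sLo) * (shearUnit n h : ℤ) - X % n) = σT * (σ * (s - k * sLo * shearUnit n h) + X % n) := by ring
  rw [hnum]
  set Y : ℤ := σ * (s - k * sLo * shearUnit n h) + X % n with hY
  have hYabs : |Y| < (k * (sHi - sLo) + q + k * R' + 2) * (shearUnit n h : ℤ) := by
    have h1 : |σ * (s - k * sLo * shearUnit n h)| = |s - k * sLo * shearUnit n h| := by rw [abs_mul, hσabs, one_mul]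
    have ex1 : (k * sLo - q - k * R') * (shearUnit n h : ℤ) = k * sLo * shearUnit n h - (q + k * R') * shearUnit n h := by ring
    have ex2 : (k * sHi + q + k * R' + 1) * (shearUnit n h : ℤ) = k * sLo * shearUnit n h + (k * (sHi - sLo) + q + k * R' + 1) * shearUnit n h := by
      ring
    have ex3 : 0 ≤ (q + k * R') * (shearUnit n h : ℤ) := by rw [hk]; positivity
    have ex4 : (q + k * R') * (shearUnit n h : ℤ) ≤ (k * (sHi - sLo) + q + k * R' + 1) * shearUnit n h := by
      have hss : sLo ≤ sHi := by
        rw [hsLo, hsHi]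
        have : ((n : ℤ) * ℓ - (shearUnit n h : ℕ) + 1) / (shearUnit n h : ℕ) ≤ (n : ℤ) * ℓ / (shearUnit n h : ℕ) :=
          Int.ediv_le_ediv hU0 (by linarith)
        linarith
      have hk0 : 0 ≤ k := by rw [hk]; positivity
      have hks := mul_nonneg hk0 (sub_nonneg.2 hss)
      exact mul_le_mul_of_nonneg_right (by linarith) hU0.le
    have h2 : |s - k * sLo * shearUnit n h| ≤ (k * (sHi - sLo) + q + k * R' + 1) * (shearUnit n h : ℤ) := by
      rw [abs_le]; constructor <;> linarith
    have h3 : |X % (n : ℤ)| < shearUnit n h := by rw [abs_lt]; constructor <;> linarith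
    calc |Y| ≤ |σ * (s - k * sLo * shearUnit n h)| + |X % (n : ℤ)| := abs_add_le _ _
      _ < (k * (sHi - sLo) + q + k * R' + 1) * (shearUnit n h : ℤ) + shearUnit n h := by rw [h1]; linarith
      _ = _ := by ring
  have hσY : |σT * Y| = |Y| := by rw [abs_mul, hσTabs, one_mul]
  have hW' : (k * (sHi - sLo) + q + k * R' + 2) * (shearUnit n h : ℤ) ≤ (((n * ℓ / shearUnit n h + 1 : ℕ) : ℤ)) * shearUnit n h :=
    mul_le_mul_of_nonneg_right (by rw [hk, hsHi, hsLo]; exact hW) hU0.le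
  have hlt := abs_lt.1 (lt_of_lt_of_le (by rw [hσY]; exact hYabs) hW')
  refine ⟨by linarith, by linarith, ?_, ?_⟩
  · rw [Int.le_ediv_iff_mul_le hU0]; linarith
  · have : σT * Y / (shearUnit n h : ℤ) < ((n * ℓ / shearUnit n h + 1 : ℕ) : ℤ) + 1 := by
      rw [Int.ediv_lt_iff_lt_mul hU0]; linarith
    linarith

end Skelφ

end Summit.CriticalPhenomena.PercolationContinuityZ3.Theorems.Transplant

end
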